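import Literature.Topology.FourManifolds.SymplecticElementaryMoves
import Literature.Topology.FourManifolds.SymplecticLagrangianKernel
import Literature.Algebra.Lie.SurfaceLieAlgebra
import Mathlib.LinearAlgebra.Span.Basic
import HarnessLib

/-!
# Helper for `CongruenceShadows.AbelianShadowStandard` (item stmt-SmoothPoincare4-14599):
# the adapted symplectic basis of a trisection lattice

Route `SmoothPoincare4/CongruenceShadows`, support item `AbelianShadowStandard` (the `c = 0`
rung of `NilpotentShadowsStandard`).  Pure symplectic linear algebra over `ℤ` on
`H = surfaceGen (3+3m) → ℤ = ℤ^{2g}` with the intersection form `ν = symplForm`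
(`Literature/Topology/FourManifolds/SurfaceGroupHomology.lean`):

* `exists_adapted_symplecticBasis` — the INTEGRAL NORMAL FORM of a "trisection lattice": three
  Lagrangians `L₀, L₁, L₂ ≤ H` (isotropic and `ν`-maximal), split surjections
  `Rp l : H → ℤ^{m+1}` killing the two `L_{l'}`, `l' ≠ l`, and `L₀ + L₁ + L₂ = H`, admit a
  symplectic basis `(α, β)` with `α_j ∈ L_l` for `l ≠ rev (j mod 3)` and `β_j ∈ L_{rev (j mod 3)}`
  — the pattern of the coordinate cut systems `s4CutSystem m` of the standard trisection of `S⁴`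
  (`Literature/Algebra/Lie/SurfaceLieAlgebra.lean`).  Construction: `ν`-duals of the rows of the
  `Rp l` (they lie in the pairwise intersections), partners from `L₀ + L₁ + L₂ = H`, Gram–Schmidt
  correction inside the `L`'s.  (The grounder's note on the item records that this integral
  classification was not located in print; nearest: Feller–Klug–Schirmer–Zemke arXiv:1711.04762
  read the homology of a trisected 4-manifold off exactly these data.)
* `mem_s4CutSystem_iff`, `mem_span_single_image_iff` — bookkeeping;
* `SurfaceGroup.mem_sup_ker_abelianize_iff` — `s ∈ A·ker(abelianize) ↔ [s] ∈ span [A]`.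
(The packaging as an isometry of `H` and the final assembly are in
`CongruenceShadowsAbelianShadowStandard.lean`.)

No new definitions; everything is proved.
-/

-- the prescribed namespace `Summit.<P>.<Sub>.…` duplicates `SmoothPoincare4` (P = Sub)
set_option linter.dupNamespace false

noncomputable section

open Finset Literature.Topology.FourManifolds

namespace Summit.SmoothPoincare4.SmoothPoincare4.Theorems.AbelianShadowStandard

section Adapted

/-- **The adapted symplectic basis of a trisection lattice** (integral normal form of the
Lagrangian triple of a `(3+3m; m+1)` group trisection of the trivial group).  Let `L₀, L₁, L₂` be
Lagrangian submodules of `H = ℤ^{2g}`, `g = 3 + 3m` (isotropic and equal to their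
`ν`-orthogonals), let `Rp l : H → ℤ^{m+1}` (`l : Fin 3`) be split surjections killing the two
`L_{l'}`, `l' ≠ l` (the exponent sums of the pairwise quotients `S/K_{l'}K_{l''} ≅ F_{m+1}`), and
let `L₀ + L₁ + L₂ = H` (the triple quotient is trivial).  Then there is a symplectic basis
`(α, β)` of `H` with `α_j ∈ L_l` for `l ≠ rev (j mod 3)` and `β_j ∈ L_{rev (j mod 3)}`: the
`ν`-duals of the rows of the `Rp l` give the `α`'s (they lie in the pairwise intersections
`L_{l'} ∩ L_{l''}`), `L₀ + L₁ + L₂ = H` provides partners `β⁰_j ∈ L_{rev (j mod 3)}` with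
`ν(α_i, β⁰_j) = δ_{ij}`, and a Gram–Schmidt correction by `α`'s of the other classes makes the
`β`'s isotropic without leaving `L_{rev (j mod 3)}`. [folklore] -/
theorem exists_adapted_symplecticBasis (m : ℕ)
    (L : Fin 3 → Submodule ℤ (surfaceGen (3 + 3 * m) → ℤ))
    (hiso : ∀ l, ∀ x ∈ L l, ∀ y ∈ L l, symplForm x y = 0)
    (hmax : ∀ l x, (∀ y ∈ L l, symplForm x y = 0) → x ∈ L l)
    (Rp : Fin 3 → ((surfaceGen (3 + 3 * m) → ℤ) →ₗ[ℤ] (Fin (m + 1) → ℤ)))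
    (Up : Fin 3 → ((Fin (m + 1) → ℤ) →ₗ[ℤ] (surfaceGen (3 + 3 * m) → ℤ)))
    (hRU : ∀ l y, Rp l (Up l y) = y)
    (hker : ∀ l l', l ≠ l' → ∀ x ∈ L l', Rp l x = 0)
    (htop : ∀ x : surfaceGen (3 + 3 * m) → ℤ, ∃ y : Fin 3 → surfaceGen (3 + 3 * m) → ℤ,
      (∀ l, y l ∈ L l) ∧ x = ∑ l, y l) :
    ∃ α β : Fin (3 + 3 * m) → surfaceGen (3 + 3 * m) → ℤ,
      IsSymplecticBasis α β ∧
      (∀ (j : Fin (3 + 3 * m)) (l : Fin 3),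
        l ≠ Fin.rev (⟨(j : ℕ) % 3, Nat.mod_lt _ (by decide)⟩ : Fin 3) → α j ∈ L l) ∧
      (∀ j : Fin (3 + 3 * m), β j ∈ L (Fin.rev (⟨(j : ℕ) % 3, Nat.mod_lt _ (by decide)⟩ : Fin 3))) := by
  -- class and index of a handle
  set cls : Fin (3 + 3 * m) → Fin 3 := fun j => ⟨(j : ℕ) % 3, Nat.mod_lt _ (by decide)⟩ with hcls
  set idx : Fin (3 + 3 * m) → Fin (m + 1) := fun j => ⟨(j : ℕ) / 3, by have := j.is_lt; omega⟩
    with hidx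
  have hinj : ∀ i j, cls i = cls j → idx i = idx j → i = j := by
    intro i j h1 h2
    simp only [hcls, hidx, Fin.ext_iff] at h1 h2
    apply Fin.ext
    have hi := Nat.div_add_mod (i : ℕ) 3
    have hj := Nat.div_add_mod (j : ℕ) 3
    omega
  have hthird : ∀ l l' : Fin 3, ∃ l'', l'' ≠ l ∧ l'' ≠ l' := by decide
  -- the `ν`-duals of the rows of the `Rp l`
  have ht' : ∀ (l : Fin 3) (c : Fin (m + 1)), ∃ w : surfaceGen (3 + 3 * m) → ℤ, ∀ x,
      symplForm w x = ((LinearMap.proj c).comp (Rp l)) x := fun l c => exists_symplForm_eq _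
  choose t ht₀ using ht'
  have ht : ∀ l c x, symplForm (t l c) x = Rp l x c := fun l c x => ht₀ l c x
  have htL : ∀ l l' c, l' ≠ l → t l c ∈ L l' := fun l l' c hl =>
    hmax l' _ fun y hy => by rw [ht, hker l l' hl.symm y hy, Pi.zero_apply]
  have hRt : ∀ l l' c, Rp l (t l' c) = 0 := by
    intro l l' c
    obtain ⟨l'', h1, h2⟩ := hthird l l'
    exact hker l l'' h1.symm _ (htL l' l'' c h2)
  have htt : ∀ l c l' c', symplForm (t l c) (t l' c') = 0 := by
    intro l c l' c'
    rw [ht, hRt, Pi.zero_apply]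
  -- the partners `β⁰`, from `L₀ + L₁ + L₂ = H`
  have hbv' : ∀ (l : Fin 3) (c : Fin (m + 1)), ∃ y ∈ L l, Rp l y = Pi.single c 1 := by
    intro l c
    obtain ⟨y, hyL, hsum⟩ := htop (Up l (Pi.single c 1))
    refine ⟨y l, hyL l, ?_⟩
    have key := congrArg (Rp l) hsum
    rw [hRU, map_sum] at key
    rw [key, Finset.sum_eq_single l (fun l' _ hl' => hker l l' (Ne.symm hl') _ (hyL l')) (by simp)]
  choose bv hbvL hbvR using hbv'
  have htbv : ∀ l c l' c', symplForm (t l c) (bv l' c') = if l = l' ∧ c = c' then 1 else 0 := by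
    intro l c l' c'
    rw [ht]
    by_cases hl : l = l'
    · subst hl
      rw [hbvR, Pi.single_apply]
      by_cases hc : c = c'
      · subst hc; simp
      · rw [if_neg hc, if_neg (fun h => hc h.2)]
    · rw [hker l l' hl _ (hbvL l' c'), Pi.zero_apply, if_neg (fun h => hl h.1)]
  have hbvbv : ∀ l c c', symplForm (bv l c) (bv l c') = 0 := fun l c c' =>
    hiso l _ (hbvL l c) _ (hbvL l c')
  -- `α` and `β⁰`
  set α : Fin (3 + 3 * m) → surfaceGen (3 + 3 * m) → ℤ := fun j => t (Fin.rev (cls j)) (idx j)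
    with hα
  set β₀ : Fin (3 + 3 * m) → surfaceGen (3 + 3 * m) → ℤ := fun j => bv (Fin.rev (cls j)) (idx j)
    with hβ₀
  have hαβ₀ : ∀ i j, symplForm (α i) (β₀ j) = if i = j then 1 else 0 := by
    intro i j
    simp only [hα, hβ₀, htbv]
    by_cases hij : i = j
    · subst hij; simp
    · rw [if_neg hij, if_neg]
      rintro ⟨h1, h2⟩
      exact hij (hinj i j (Fin.rev_injective h1) h2)
  have hαα : ∀ i j, symplForm (α i) (α j) = 0 := fun i j => htt _ _ _ _
  have hβ₀α : ∀ i j, symplForm (β₀ i) (α j) = -(if j = i then 1 else 0) := fun i j => by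
    rw [symplForm_comm, hαβ₀]
  -- the correction
  set cf : Fin (3 + 3 * m) → Fin (3 + 3 * m) → ℤ :=
    fun i j => if cls i < cls j then symplForm (β₀ i) (β₀ j) else 0 with hcf
  set β : Fin (3 + 3 * m) → surfaceGen (3 + 3 * m) → ℤ := fun i => β₀ i - ∑ j, cf i j • α j
    with hβ
  have p1 : ∀ i j, symplForm (β₀ i) (∑ b, cf j b • α b) = -cf j i := by
    intro i j
    rw [map_sum, Finset.sum_eq_single i (fun b _ hb => by rw [map_zsmul, hβ₀α, if_neg hb]; simp)
      (by simp), map_zsmul, hβ₀α, if_pos rfl, smul_eq_mul, mul_neg_one]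
  have h0 : ∀ i x, symplForm (∑ a, cf i a • α a) x = ∑ a, cf i a * symplForm (α a) x := by
    intro i x
    rw [map_sum, LinearMap.sum_apply]
    refine Finset.sum_congr rfl fun a _ => ?_
    rw [map_zsmul, LinearMap.smul_apply, smul_eq_mul]
  have p2 : ∀ i j, symplForm (∑ a, cf i a • α a) (β₀ j) = cf i j := by
    intro i j
    rw [h0, Finset.sum_eq_single j (fun a _ ha => by rw [hαβ₀, if_neg ha, mul_zero]) (by simp),
      hαβ₀, if_pos rfl, mul_one]
  have p3 : ∀ i j, symplForm (∑ a, cf i a • α a) (∑ b, cf j b • α b) = 0 := by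
    intro i j
    rw [h0]
    refine Finset.sum_eq_zero fun a _ => ?_
    rw [map_sum, Finset.sum_eq_zero fun b _ => by rw [map_zsmul, hαα, smul_zero], mul_zero]
  have hαβ : ∀ i j, symplForm (α i) (β j) = if i = j then 1 else 0 := by
    intro i j
    simp only [hβ]
    rw [map_sub, hαβ₀, map_sum, Finset.sum_eq_zero fun b _ => by rw [map_zsmul, hαα, smul_zero],
      sub_zero]
  have hββ : ∀ i j, symplForm (β i) (β j) = 0 := by
    intro i j
    have e1 : symplForm (β i) (β j) = symplForm (β₀ i) (β₀ j) + cf j i - cf i j := by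
      simp only [hβ]
      rw [LinearMap.map_sub₂, map_sub, map_sub, p1, p2, p3]
      ring
    rw [e1]
    simp only [hcf]
    rcases lt_trichotomy (cls i) (cls j) with h | h | h
    · rw [if_pos h, if_neg (not_lt.2 h.le)]
      ring
    · rw [if_neg (by rw [h]; exact lt_irrefl _), if_neg (by rw [h]; exact lt_irrefl _)]
      simp only [hβ₀]
      rw [h, hbvbv]
      ring
    · rw [if_neg (not_lt.2 h.le), if_pos h, symplForm_comm (β₀ j)]
      ring
  -- memberships
  have hαL : ∀ j l, l ≠ Fin.rev (cls j) → α j ∈ L l := fun j l hl => htL _ _ _ hl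
  have hβL : ∀ j, β j ∈ L (Fin.rev (cls j)) := by
    intro j
    simp only [hβ]
    refine Submodule.sub_mem _ (hbvL _ _) (Submodule.sum_mem _ fun j' _ => ?_)
    by_cases h : cls j < cls j'
    · refine Submodule.smul_mem _ _ (hαL j' _ fun heq => ?_)
      exact (ne_of_lt h) (Fin.rev_injective heq)
    · simp only [hcf, if_neg h, zero_smul]
      exact Submodule.zero_mem _
  exact ⟨α, β, ⟨hαβ, hαα, hββ⟩, hαL, hβL⟩

end Adapted

/-! ## Final assembly (Summits side) -/

section CutSystems

open Literature.Algebra.Lie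

/-- Membership in the coordinate cut systems, by residue class of the handle: `(j, b) ∈ Cᵢ` iff
`b = true ∧ rev (j mod 3) = i` or `b = false ∧ rev (j mod 3) ≠ i`. [folklore] -/
theorem mem_s4CutSystem_iff (m : ℕ) (i : Fin 3) (j : Fin (3 + 3 * m)) (b : Bool) :
    ((j, b) ∈ s4CutSystem m i) ↔
      (if b = true then Fin.rev (⟨(j : ℕ) % 3, Nat.mod_lt _ (by decide)⟩ : Fin 3) = i
        else Fin.rev (⟨(j : ℕ) % 3, Nat.mod_lt _ (by decide)⟩ : Fin 3) ≠ i) := by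
  have key : ∀ (r i : Fin 3) (b : Bool),
      ((r, b) ∈ s4Gens i) ↔ (if b = true then Fin.rev r = i else Fin.rev r ≠ i) := by decide
  exact key _ i b

end CutSystems

section SpanSingles

variable {X : Type*} [Fintype X] [DecidableEq X]

/-- The span of the coordinate vectors `δ_y`, `y ∈ C`, consists of the vectors supported on `C`.
[folklore] -/
theorem mem_span_single_image_iff (C : Set X) (u : X → ℤ) :
    u ∈ Submodule.span ℤ ((fun y => (Pi.single y (1 : ℤ) : X → ℤ)) '' C) ↔ ∀ y, y ∉ C → u y = 0 := by
  constructor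
  · intro hu
    induction hu using Submodule.span_induction with
    | mem v hv =>
      obtain ⟨y', hy', rfl⟩ := hv
      intro y hy
      exact Pi.single_eq_of_ne (by rintro rfl; exact hy hy') _
    | zero => intro y _; rfl
    | add v w _ _ hv hw => intro y hy; rw [Pi.add_apply, hv y hy, hw y hy, add_zero]
    | smul c v _ hv => intro y hy; rw [Pi.smul_apply, hv y hy, smul_zero]
  · intro hu
    rw [← Finset.univ_sum_single u]
    refine Submodule.sum_mem _ fun y _ => ?_
    by_cases hy : y ∈ C
    · have : (Pi.single y (u y) : X → ℤ) = u y • (Pi.single y (1 : ℤ) : X → ℤ) := by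
        ext z; simp [Pi.single_apply]
      rw [this]
      exact Submodule.smul_mem _ _ (Submodule.subset_span ⟨y, hy, rfl⟩)
    · rw [hu y hy, Pi.single_zero]
      exact Submodule.zero_mem _

end SpanSingles




section SupKer

open Multiplicative

/-- `s ∈ A ⊔ ker(abelianize) ↔ [s] ∈ span [A]`: a subgroup enlarged by the commutator subgroup is
the preimage of its image in `H₁`. [folklore] -/
theorem SurfaceGroup.mem_sup_ker_abelianize_iff {g : ℕ} (A : Subgroup (SurfaceGroup g))
    (s : SurfaceGroup g) :
    s ∈ A ⊔ (SurfaceGroup.abelianize g).ker ↔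
      toAdd (SurfaceGroup.abelianize g s) ∈
        Submodule.span ℤ ((fun s => toAdd (SurfaceGroup.abelianize g s)) '' (A : Set (SurfaceGroup g))) := by
  constructor
  · intro hs
    rw [Subgroup.sup_eq_closure] at hs
    induction hs using Subgroup.closure_induction with
    | mem x hx =>
      rcases hx with hx | hx
      · exact Submodule.subset_span ⟨x, hx, rfl⟩
      · rw [SetLike.mem_coe, MonoidHom.mem_ker] at hx
        rw [hx, toAdd_one]
        exact Submodule.zero_mem _
    | one => simp
    | mul x y _ _ hx hy =>
      simp only [map_mul, toAdd_mul]
      exact Submodule.add_mem _ hx hy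
    | inv x _ hx =>
      simp only [map_inv, toAdd_inv]
      exact Submodule.neg_mem _ hx
  · intro hs
    have key : ∀ v ∈ Submodule.span ℤ
        ((fun s => toAdd (SurfaceGroup.abelianize g s)) '' (A : Set (SurfaceGroup g))),
        ∃ a ∈ A, toAdd (SurfaceGroup.abelianize g a) = v := by
      intro v hv
      induction hv using Submodule.span_induction with
      | mem v hv =>
        obtain ⟨a, ha, rfl⟩ := hv
        exact ⟨a, ha, rfl⟩
      | zero => exact ⟨1, A.one_mem, by simp⟩
      | add v w _ _ hv hw =>
        obtain ⟨a, ha, rfl⟩ := hv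
        obtain ⟨b, hb, rfl⟩ := hw
        exact ⟨a * b, A.mul_mem ha hb, by simp only [map_mul, toAdd_mul]⟩
      | smul c v _ hv =>
        obtain ⟨a, ha, rfl⟩ := hv
        exact ⟨a ^ c, A.zpow_mem ha c, by simp only [map_zpow, toAdd_zpow]⟩
    obtain ⟨a, ha, hav⟩ := key _ hs
    have hmem : a⁻¹ * s ∈ (SurfaceGroup.abelianize g).ker := by
      rw [MonoidHom.mem_ker, map_mul, map_inv, ← ofAdd_toAdd (SurfaceGroup.abelianize g a), hav,
        ofAdd_toAdd, inv_mul_cancel]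
    rw [show s = a * (a⁻¹ * s) by group]
    exact Subgroup.mul_mem _ (Subgroup.mem_sup_left ha) (Subgroup.mem_sup_right hmem)

end SupKer

end Summit.SmoothPoincare4.SmoothPoincare4.Theorems.AbelianShadowStandard

end
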